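/-
Copyright (c) 2026 the pub-hodgecm-mathlib formalisation cell (harness21).  Prover seat hodgecm-mathlib-K2Liu-p05 (g6), Track B «K2-LIT»,
#184♮ = hLiu418 = `stmt-HodgeConjecture-24832`; #42S organ S2, S2-asm road (γ): the GENERIC HALF of the (der) instance of ★ `K2LiuArchSWSpanningInstance`
(LEAD F0P6-plan (g14) BATCH #41: «(der) second hand with p05 … p05 cuts it in two named files»; census `CENSUS-hsys-instance.K2Liu-p05-g6.md` 2cffbe307430ce68).
-/
import Mathlib.Analysis.Calculus.Deriv.Mul
import Mathlib.Analysis.Calculus.Deriv.Add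
import Mathlib.Analysis.Complex.Basic
import Mathlib.LinearAlgebra.Span.Basic
import HarnessLib

/-!
# Crux `HLiu418`, S2-asm road (γ), (der) GENERIC HALF: THE DERIVATIVE CLAUSE EXTENDS LINEARLY FROM A SPANNING SET OF TEST DATA

Cell `hodgecm-mathlib`, crux item hLiu418 = `stmt-HodgeConjecture-24832`; squad K2 ∕ K2Liu; LEAD F0P6-plan (g14), co-dealer K2E5-plan (g7); prover K2Liu-p05 (g6).
THEOREMS ONLY (no `def`, no `instance`, no notation, no named-fact hypothesis, no `sorry`); lane `--supports stmt-HodgeConjecture-24832 --as helper`.  Mathlib only.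

THE CLAUSE.  ★ p861135 `archSWRegionSpanning_of_readings` asks, per place `w`, for the derivative clause
(derv) `∀ Φ, ∃ Φ′, ∀ y u, uᴴu = 1 → HasDerivAt (t ↦ val Φ (γ y u t)) (val Φ′ (g₀ y u)) 0`
of a LINEAR value map `val : 𝔉 →ₗ[ℂ] (G → ℂ)` along curves `γ` with base points `g₀`.  ★ (r-b)-uniform p860738 delivers it on the PURE-TENSOR ∕ Hermite data (a spanning set
`B` of `𝔉`).  This file is the linear-algebra step «(derv) on `B` ⇒ (derv) on `span B = 𝔉`»: the set of `Φ` admitting a `Φ′` is a submodule (`Φ′ := 0`, `Φ′₁ + Φ′₂`, `c • Φ′`;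
`HasDerivAt.add`, `HasDerivAt.const_mul`, linearity of `val`), so `Submodule.span_induction` concludes.
* `derivClause_of_span` — one index type `X` with a guard `P : X → Prop`;
* `derivClause_of_span₂` — the two-argument shape `∀ y u, P u → …` of ★ ED. 2's (derv) verbatim (instance: `y` the frozen tuple, `u` unitary, `P u := uᴴ * u = 1`).
References: [Folland1989] Prop. (4.39) (smooth vectors of the Weil representation; derivatives of polynomial × Gaussian data); [Howe1989] §3; [KudlaRallis1994] §1.
HONEST LABEL.  Count-neutral helper: `HC_CM` is proved only modulo the 7 printed citations (2 remaining named inputs: hLiu418 = `stmt-HodgeConjecture-24832`,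
h413 = `stmt-HodgeConjecture-24833`) until rung 0 closes; this file closes no socket.
-/

set_option autoImplicit false
set_option linter.dupNamespace false -- the mandated namespace repeats `HodgeConjecture.HodgeConjecture`

namespace Summit.HodgeConjecture.HodgeConjecture.Cruxes.HLiu418.K2LiuDerivativeClauseLinearExtension

variable {𝔉 : Type*} [AddCommGroup 𝔉] [Module ℂ 𝔉] {G : Type*} {X : Type*}

/-- the clause holds for `Φ = 0` with `Φ′ = 0`. [folklore] -/
theorem derivClause_zero (val : 𝔉 →ₗ[ℂ] (G → ℂ)) (γ : X → ℝ → G) (g₀ : X → G) (x : X) :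
    HasDerivAt (fun t : ℝ => val (0 : 𝔉) (γ x t)) (val (0 : 𝔉) (g₀ x)) 0 := by
  simp only [map_zero, Pi.zero_apply]
  exact hasDerivAt_const (0 : ℝ) (0 : ℂ)

/-- the clause is additive in `(Φ, Φ′)`. [folklore] -/
theorem derivClause_add (val : 𝔉 →ₗ[ℂ] (G → ℂ)) (γ : X → ℝ → G) (g₀ : X → G) {Φ₁ Φ₂ Φ₁' Φ₂' : 𝔉} (x : X)
    (h₁ : HasDerivAt (fun t : ℝ => val Φ₁ (γ x t)) (val Φ₁' (g₀ x)) 0) (h₂ : HasDerivAt (fun t : ℝ => val Φ₂ (γ x t)) (val Φ₂' (g₀ x)) 0) :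
    HasDerivAt (fun t : ℝ => val (Φ₁ + Φ₂) (γ x t)) (val (Φ₁' + Φ₂') (g₀ x)) 0 := by
  simp only [map_add, Pi.add_apply]
  exact h₁.add h₂

/-- the clause is homogeneous in `(Φ, Φ′)`. [folklore] -/
theorem derivClause_smul (val : 𝔉 →ₗ[ℂ] (G → ℂ)) (γ : X → ℝ → G) (g₀ : X → G) {Φ Φ' : 𝔉} (c : ℂ) (x : X)
    (h : HasDerivAt (fun t : ℝ => val Φ (γ x t)) (val Φ' (g₀ x)) 0) :
    HasDerivAt (fun t : ℝ => val (c • Φ) (γ x t)) (val (c • Φ') (g₀ x)) 0 := by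
  simp only [map_smul, Pi.smul_apply, smul_eq_mul]
  exact h.const_mul c

/-- **(der) GENERIC HALF: THE DERIVATIVE CLAUSE ON A SPANNING SET EXTENDS TO THE SPAN.**  If every `Φ ∈ B` has a `Φ′` with `HasDerivAt (t ↦ val Φ (γ x t)) (val Φ′ (g₀ x)) 0`
for all admissible `x` (`P x`), and `span B = ⊤`, then every `Φ : 𝔉` has such a `Φ′`. [cite: Folland1989, Prop. (4.39)] [cite: Howe1989, §3] -/
theorem derivClause_of_span (val : 𝔉 →ₗ[ℂ] (G → ℂ)) (γ : X → ℝ → G) (g₀ : X → G) (P : X → Prop) (B : Set 𝔉) (hB : Submodule.span ℂ B = ⊤)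
    (h : ∀ Φ ∈ B, ∃ Φ' : 𝔉, ∀ x, P x → HasDerivAt (fun t : ℝ => val Φ (γ x t)) (val Φ' (g₀ x)) 0) (Φ : 𝔉) :
    ∃ Φ' : 𝔉, ∀ x, P x → HasDerivAt (fun t : ℝ => val Φ (γ x t)) (val Φ' (g₀ x)) 0 := by
  have hΦ : Φ ∈ Submodule.span ℂ B := by rw [hB]; exact Submodule.mem_top
  induction hΦ using Submodule.span_induction with
  | mem Ψ hΨ => exact h Ψ hΨ
  | zero => exact ⟨0, fun x _ => derivClause_zero val γ g₀ x⟩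
  | add Ψ₁ Ψ₂ _ _ ih₁ ih₂ =>
    obtain ⟨Ψ₁', h₁⟩ := ih₁
    obtain ⟨Ψ₂', h₂⟩ := ih₂
    exact ⟨Ψ₁' + Ψ₂', fun x hx => derivClause_add val γ g₀ x (h₁ x hx) (h₂ x hx)⟩
  | smul c Ψ _ ih =>
    obtain ⟨Ψ', h'⟩ := ih
    exact ⟨c • Ψ', fun x hx => derivClause_smul val γ g₀ c x (h' x hx)⟩

/-- **THE SAME IN THE TWO-ARGUMENT SHAPE of ★ ED. 2 `archSWRegionSpanning_of_readings`' (derv)**: curves `γ y u`, base points `g₀ y u`, guard `P u` (instance: `y` the frozen tuple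
`Π w′, archLocal w′`, `u : M₂(ℂ)` with `P u := uᴴ * u = 1`, `γ y u t := archPiEquivCM⁻¹ (y[w ↦ ιw w (k_u · exp tX)])`, `g₀ y u := archPiEquivCM⁻¹ (y[w ↦ ιw w k_u])`).
[cite: Folland1989, Prop. (4.39)] [cite: Howe1989, §3] -/
theorem derivClause_of_span₂ {Y U : Type*} (val : 𝔉 →ₗ[ℂ] (G → ℂ)) (γ : Y → U → ℝ → G) (g₀ : Y → U → G) (P : U → Prop) (B : Set 𝔉)
    (hB : Submodule.span ℂ B = ⊤)
    (h : ∀ Φ ∈ B, ∃ Φ' : 𝔉, ∀ y u, P u → HasDerivAt (fun t : ℝ => val Φ (γ y u t)) (val Φ' (g₀ y u)) 0) (Φ : 𝔉) :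
    ∃ Φ' : 𝔉, ∀ y u, P u → HasDerivAt (fun t : ℝ => val Φ (γ y u t)) (val Φ' (g₀ y u)) 0 := by
  obtain ⟨Φ', hΦ'⟩ := derivClause_of_span val (fun x : Y × U => γ x.1 x.2) (fun x => g₀ x.1 x.2) (fun x => P x.2) B hB
    (fun Ψ hΨ => by
      obtain ⟨Ψ', hΨ'⟩ := h Ψ hΨ
      exact ⟨Ψ', fun x hx => hΨ' x.1 x.2 hx⟩) Φ
  exact ⟨Φ', fun y u hu => hΦ' (y, u) hu⟩

/-- **… AND WITH A FAMILY OF CLAUSES** (one per place `w` and Lie element `X`): if for every parameter `i` the clause with curves `γ i` and base points `g₀ i` holds on `B`, it holds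
on `𝔉` for every `i` — the literal shape `∀ w Φ αβγδ, hX → ∃ Φ′, ∀ y u, …` is the case `i := (w, α, β, γ, δ, hX)`. [cite: Folland1989, Prop. (4.39)] -/
theorem derivClause_of_span_family {I Y U : Type*} (val : 𝔉 →ₗ[ℂ] (G → ℂ)) (γ : I → Y → U → ℝ → G) (g₀ : I → Y → U → G) (P : U → Prop) (B : Set 𝔉)
    (hB : Submodule.span ℂ B = ⊤)
    (h : ∀ i, ∀ Φ ∈ B, ∃ Φ' : 𝔉, ∀ y u, P u → HasDerivAt (fun t : ℝ => val Φ (γ i y u t)) (val Φ' (g₀ i y u)) 0) (i : I) (Φ : 𝔉) :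
    ∃ Φ' : 𝔉, ∀ y u, P u → HasDerivAt (fun t : ℝ => val Φ (γ i y u t)) (val Φ' (g₀ i y u)) 0 :=
  derivClause_of_span₂ val (γ i) (g₀ i) P B hB (h i) Φ

end Summit.HodgeConjecture.HodgeConjecture.Cruxes.HLiu418.K2LiuDerivativeClauseLinearExtension
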